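import Summits.BirchSwinnertonDyer.BirchSwinnertonDyer.Theorems.ManinLocalTwoThreeCuspThreeTorsionAtFour
import Summits.BirchSwinnertonDyer.Rank1Residual.ManinAdditive.CuspUnipotentDegreeLaw
import HarnessLib

/-!
# S-an-4 `CuspWidthThreeTorsionSymbol` holds: `3·{∞, 1/(N/4)}_f ∈ Λ_f` for every newform `f` on `Γ₀(N)`, `4 ∥ N`

Summit `BirchSwinnertonDyer`, sub-problem `BirchSwinnertonDyer`, route `ManinLocalTwoThree`; width seat `bsd-line-manin23-p2`
(gen 9), `--supports` the crux C2 `ManinOddAtFour` (stmt-BirchSwinnertonDyer-22967).  Cell `bsd-f2-manin`, an lens leaf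
`…ManinAdditive.CuspUnipotentDegreeLaw` (S-an-4, «THEOREM TARGET — statement-to-prove»; Watkins 2002 §4: the `3 ∣ deg φ` excess at
`4 ∥ N`).  The content is the tree theorem `cuspThreeTorsionAtFourExact_holds` (E-an-45, seat p2 gen 8: the five cusp relations at
level `4M`, `M` odd, from the order-`3` element `τ₃ = w(4)·t` of the normaliser); this file is the binder glue from the leaf's
level-`N` form (`2² ∣ N`, `2³ ∤ N`, cusp `1/(N/4)`) to the level-`4M` form.

PROVED here (no `sorry`): **`cuspWidthThreeTorsionSymbol_holds : CuspWidthThreeTorsionSymbol`** (S-an-4 BY NAME).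
BSD is not proved by this; Manin's conjecture is not proved by this.
-/

set_option autoImplicit false
set_option linter.dupNamespace false

noncomputable section

open scoped MatrixGroups ModularForm
open CongruenceSubgroup
open Literature.NumberTheory.EllipticCurves Literature.NumberTheory.EllipticCurves.ModularForms
open Summit.BirchSwinnertonDyer.Rank1Residual.ManinAdditive

namespace Summit.BirchSwinnertonDyer.BirchSwinnertonDyer.Theorems.ManinLocalTwoThree

/-- Level `4M`, `M` odd: `3·{∞, 1/M}_f ∈ Λ_f` for every newform (E-an-45, first conjunct; the even-coefficient clause is supplied by
newness at `4 ∣ N`). -/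
theorem three_mul_modularSymbol_inv_mem_periodLattice {M : ℕ} [NeZero (4 * M)] (hM : Odd M) (f : CuspForm (Gamma0 (4 * M)) 2)
    (hf : IsNewform0 f) : 3 * modularSymbol f (1 / (M : ℚ)) ∈ periodLattice f :=
  (cuspThreeTorsionAtFourExact_holds hM f hf fun _ hn =>
    Literature.NumberTheory.Automorphic.IsNewform0.cuspCoeff_eq_zero_of_two_dvd hf (dvd_mul_right 4 M) hn).1

/-- **S-an-4 `CuspWidthThreeTorsionSymbol` IS A THEOREM**: for a newform `f` on `Γ₀(N)` with `4 ∥ N`, `3·{∞, 1/(N/4)}_f ∈ Λ_f`.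
BSD is not proved by this. -/
theorem cuspWidthThreeTorsionSymbol_holds : CuspWidthThreeTorsionSymbol := by
  intro N _ f hf h4 h8
  obtain ⟨M, rfl⟩ : 4 ∣ N := by simpa using h4
  have hM : Odd M := by
    rcases Nat.even_or_odd M with ⟨k, hk⟩ | hodd
    · exact absurd (show 2 ^ 3 ∣ 4 * M from ⟨k, by rw [hk]; ring⟩) h8
    · exact hodd
  have hdiv : 4 * M / 4 = M := Nat.mul_div_cancel_left M (by norm_num)
  refine ⟨3 * modularSymbol f (1 / (M : ℚ)), three_mul_modularSymbol_inv_mem_periodLattice hM f hf, ?_⟩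
  rw [hdiv]

end Summit.BirchSwinnertonDyer.BirchSwinnertonDyer.Theorems.ManinLocalTwoThree

end
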